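import Summits.BirchSwinnertonDyer.Rank1Residual.GaloisImage.HauptmodulDeltaUnitValuation
import HarnessLib

/-!
# The level-`9` Hauptmodul at `v₃(j) = 3k + 3 ≥ 6`, `j/3^{v₃(j)} ≡ 4w₀ (mod 9)` (`w₀ = ±1`) is
# VALUATION-FORCED: `v((2((θ³ − 24)/3^{k+1} − w₀)/θ)² − 1)⁹ = v(3)` — the `K ≡ ±4 (mod 9)` twin of
# `HauptmodulNineValuationVZero` (`K ≡ ∓2`)
# (cell `b2b-bsdres`, team n1011, seat p02 gen 6 — row T-b11-F4-END, file F4c-H21 'Hauptmodul route,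
# curve-free core at v₃(j) ≡ 0 (mod 3), v₃(j) ≥ 6, K ≡ ±4'; pure valuation algebra in `ℚ̄`)

HONEST FRAMING (cell `b2b-bsdres`, run/shared/lean/b2b/bsd-rank1-residual/, verbatim in every
file): the goal of the cell is to DELETE the COMBINATION-SHAPED residual classes of the
Birch–Swinnerton-Dyer formula for ALL analytic-rank `≤ 1` elliptic curves over `ℚ` — "full BSD
formula for every rank `≤ 1` curve in class `C`" assembled STRICTLY from published theorems — so
that the rank-`≤ 1` remainder becomes exactly the CONSTRUCTION-SHAPED classes, which are TYPED
(missing-input `Prop`s), NOT attempted. This is not "finishing BSD". Team n1011 (N10 / N11):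
research route; no claim beyond the stated classes; labels UNCHANGED; nothing is booked. Theorems
only (no definition, no named fact).

## What this file proves

`v` the place of `ℚ̄` over `3`, `t = v(3)`; `V = 3k + 3` (`k ≥ 1`), `K = j/3^V` a `3`-adic unit,
`S = θ³ = 3(3^k w + 8)` the non-canonical level-`3` Hauptmodul, `w³(3^k w + 8) = K(3^k w − 1)`,
`v(w) = 1` (`HauptmodulDeltaQuarticValuation.valuation_w_eq_one`).

* `valuation_w_cube_sub_eq_four` — `v(K − 4w₀) ≤ t²` (`K ≡ 4w₀ (mod 9)`) ⟹ `v(w³ − w₀) = t`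
  (`K + 8w₀ = (K − 4w₀) + 12w₀`).  Hence `v(w − w₀)³ = t` (`valuation_w_sub_pow_three_eq`).
* `valuation_numerator_of_delta_quartic_four` — `v(8w₀(w − w₀)³ − 3(3^k w + 8)) = t·v(w − w₀)`
  (the numerator of `X³ − 1` for `X = +2w₀(w − w₀)/θ`; after multiplying by `3^k w + 8` the term
  `−24(3^k w + 8)w(w − w₀)` dominates, the constant `−8(w₀K + 32) = −8w₀(K − 4w₀) − 288` is `O(9)`).
* **`valuation_hauptmodul_nine_invariant_vzero_four_pow_nine`** — `k ≥ 1`, `w₀ = ±1`, `j ∈ ℚ` with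
  `9 ∣ num(j/3^{3k+3} − 4w₀)`, `S, θ ∈ ℚ̄` with `j(S − 27) = S(S − 24)³`, `v(S) = t`, `θ³ = S` ⟹
  **`v((2((θ³ − 24)/3^{k+1} − w₀)/θ)² − 1)⁹ = t`** — valuation exactly `1/9`.

So on `v₃(j) ≡ 0 (mod 3)`, `v₃(j) ≥ 6` the SAME element `z = (2((θ³ − 24)/3^{k+1} − w₀)/θ)² − 1`
with `w₀ ≡ K (mod 3)` works for every `K ≢ ±1 (mod 9)`: gen 5's `…VZero` files prove `K ≡ −2w₀`,
this file `K ≡ 4w₀`; the remaining `K ≡ ±1 (mod 9)` has `w³ ≡ K` a cube in `ℤ₃` up to `O(27)`,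
`e(ℚ₃(δ)) ≤ 2`, and no prime of `ℚ(θ)` over `3` with `9 ∣ ef`.  The class `K ≡ ±4` carries NO
cell of the cell's `m = 3` census (kit j135556); it is filed so that the EXOTIC signature after the
Hauptmodul route (`HauptmodulExoticSignature`) is the SHARP list.  EVIDENCE on synthetic `j`
(kit j137075: `j = 3^V·K`, `V ∈ {6, 9, 12, 15}`, `K ∈ {4, 5, 13, 14, 2/5, 10/7, 1/2}`: `e = 9` and
`ord z = 1/9` on 11/11; controls `K ≡ ±1`: `e ≤ 6`, 6/6).  Nothing booked.

References: [Maier2006] Table 4 (N = 3, 9), §5.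
-/

noncomputable section

set_option maxRecDepth 10000

open scoped Classical

namespace Summit.BirchSwinnertonDyer.Rank1Residual.GaloisImage

open Literature.NumberTheory.EllipticCurves Literature.NumberTheory.GaloisRepresentations
  Rat.HeightOneSpectrum

/-! ### §1 `w³ ≡ w₀ (mod 3)` exactly, for `K ≡ 4w₀ (mod 9)` -/

/-- **`v(w³ − w₀) = v(3)`** when `K ≡ 4w₀ (mod 9)` (`w₀ = ±1`): `(w³ − w₀)(3^k w + 8) =
(K − w₀)3^k w − (K + 8w₀)` with `v((K − w₀)3^k w) ≤ t²` and `K + 8w₀ = (K − 4w₀) + 12w₀` of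
valuation exactly `t`. [folklore] -/
theorem valuation_w_cube_sub_eq_four {w K w₀ : AlgebraicClosure ℚ} {k : ℕ} (hk : 1 ≤ k)
    (hw₀ : w₀ = 1 ∨ w₀ = -1)
    (hK4 : (placeOver 3).valuation (K - 4 * w₀) ≤ (placeOver 3).valuation (3 : AlgebraicClosure ℚ) ^ 2)
    (hw : (placeOver 3).valuation w = 1)
    (h8 : (placeOver 3).valuation ((3 : AlgebraicClosure ℚ) ^ k * w + 8) = 1)
    (hR : w ^ 3 * ((3 : AlgebraicClosure ℚ) ^ k * w + 8) = K * ((3 : AlgebraicClosure ℚ) ^ k * w - 1)) :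
    (placeOver 3).valuation (w ^ 3 - w₀) = (placeOver 3).valuation (3 : AlgebraicClosure ℚ) := by
  set v := (placeOver 3).valuation with hv
  set t := v (3 : AlgebraicClosure ℚ) with ht
  have ht1 : t < 1 := valuation_three_lt_one
  have ht0 : t ≠ 0 := valuation_three_ne_zero
  have ht0' : 0 < t := zero_lt_iff.mpr ht0
  have ht2t : t ^ 2 < t := by
    calc t ^ 2 = t * t := pow_two t
      _ < t * 1 := mul_lt_mul_of_pos_left ht1 ht0'
      _ = t := mul_one t
  have hvw₀ : v w₀ = 1 := by
    rcases hw₀ with h | h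
    · rw [h, map_one]
    · rw [h, Valuation.map_neg, map_one]
  have h4 : v (4 : AlgebraicClosure ℚ) = 1 := by
    simpa using valuation_intCast_eq_one_of_not_dvd (n := 4) (by decide)
  -- `v(K + 8w₀) = t`
  have hK8 : v (K + 8 * w₀) = t := by
    have e : K + 8 * w₀ = 4 * 3 * w₀ + (K - 4 * w₀) := by ring
    have hm : v (4 * 3 * w₀) = t := by rw [map_mul, map_mul, h4, hvw₀, one_mul, mul_one]
    rw [e, Valuation.map_add_eq_of_lt_left _ (by rw [hm]; exact hK4.trans_lt ht2t), hm]
  -- `v((K − w₀) 3^k w) ≤ t²`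
  have hKw : v ((K - w₀) * (3 : AlgebraicClosure ℚ) ^ k * w) ≤ t ^ 2 := by
    have hKw₀ : v (K - w₀) ≤ t := by
      have e : K - w₀ = (K - 4 * w₀) + 3 * w₀ := by ring
      rw [e]
      refine (Valuation.map_add _ _ _).trans (max_le (hK4.trans ht2t.le) ?_)
      rw [map_mul, hvw₀, mul_one]
    rw [map_mul, map_mul, map_pow, hw, mul_one]
    calc v (K - w₀) * t ^ k ≤ t * t ^ 1 :=
          mul_le_mul' hKw₀ (pow_le_pow_right_of_le_one' ht1.le hk)
      _ = t ^ 2 := by rw [pow_one, pow_two]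
  -- the identity
  have hid : (w ^ 3 - w₀) * ((3 : AlgebraicClosure ℚ) ^ k * w + 8) =
      (K - w₀) * (3 : AlgebraicClosure ℚ) ^ k * w - (K + 8 * w₀) := by
    linear_combination hR
  have hval := congrArg v hid
  rw [map_mul, h8, mul_one] at hval
  rw [hval, valuation_sub_eq_of_lt' (by rw [hK8]; exact hKw.trans_lt ht2t), hK8]

/-! ### §2 The numerator of `X³ − 1` for `X = +2w₀(w − w₀)/θ` -/

/-- **`v(8w₀(w − w₀)³ − 3(3^k w + 8)) = v(3)·v(w − w₀)`** (`K ≡ 4w₀ (mod 9)`): with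
`P = 3^k w + 8`, `N'·P = −24P·w(w − w₀) + [8·3^k w₀(K − w₀)w − 8w₀(K − 4w₀) − 288 − 48·3^k w −
3(3^k w)²]`, the first term of valuation `t·v(w − w₀)`, the bracket `≤ t²`. [folklore] -/
theorem valuation_numerator_of_delta_quartic_four {w K w₀ : AlgebraicClosure ℚ} {k : ℕ} (hk : 1 ≤ k)
    (hw₀ : w₀ = 1 ∨ w₀ = -1)
    (hK4 : (placeOver 3).valuation (K - 4 * w₀) ≤ (placeOver 3).valuation (3 : AlgebraicClosure ℚ) ^ 2)
    (hw : (placeOver 3).valuation w = 1)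
    (h8' : (placeOver 3).valuation ((3 : AlgebraicClosure ℚ) ^ k * w + 8) = 1)
    (hR : w ^ 3 * ((3 : AlgebraicClosure ℚ) ^ k * w + 8) = K * ((3 : AlgebraicClosure ℚ) ^ k * w - 1))
    (hs : (placeOver 3).valuation (w - w₀) ^ 3 = (placeOver 3).valuation (3 : AlgebraicClosure ℚ)) :
    (placeOver 3).valuation (8 * w₀ * (w - w₀) ^ 3 - 3 * ((3 : AlgebraicClosure ℚ) ^ k * w + 8)) =
      (placeOver 3).valuation (3 : AlgebraicClosure ℚ) * (placeOver 3).valuation (w - w₀) := by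
  set v := (placeOver 3).valuation with hv
  set t := v (3 : AlgebraicClosure ℚ) with ht
  set s := v (w - w₀) with hsdef
  have ht1 : t < 1 := valuation_three_lt_one
  have ht0 : t ≠ 0 := valuation_three_ne_zero
  have ht0' : 0 < t := zero_lt_iff.mpr ht0
  have hvw₀ : v w₀ = 1 := by
    rcases hw₀ with h | h
    · rw [h, map_one]
    · rw [h, Valuation.map_neg, map_one]
  have hunit : ∀ n : ℤ, ¬ (3 : ℤ) ∣ n → v (n : AlgebraicClosure ℚ) = 1 := fun n hn ↦
    valuation_intCast_eq_one_of_not_dvd hn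
  have h8 : v (8 : AlgebraicClosure ℚ) = 1 := by simpa using hunit 8 (by decide)
  have ht2t : t ^ 2 < t := by
    calc t ^ 2 = t * t := pow_two t
      _ < t * 1 := mul_lt_mul_of_pos_left ht1 ht0'
      _ = t := mul_one t
  -- `t < s` (from `s³ = t < 1`)
  have hs0' : 0 < s := by
    rcases eq_or_lt_of_le (zero_le : (0 : _) ≤ s) with h | h
    · exfalso
      have : s ^ 3 = 0 := by rw [← h, zero_pow three_ne_zero]
      rw [hs] at this; exact ht0 this
    · exact h
  have hts : t < s := by
    refine lt_of_pow_lt_pow_left₀ 3 hs0'.le ?_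
    rw [hs]
    calc t ^ 3 = t * t ^ 2 := by rw [← pow_succ']
      _ < t * 1 := mul_lt_mul_of_pos_left (pow_lt_one₀ zero_le ht1 two_ne_zero) ht0'
      _ = t := mul_one t
  have ht2ts : t ^ 2 < t * s := by
    rw [pow_two]; exact mul_lt_mul_of_pos_left hts ht0'
  -- the identity for `N'·P`
  have hid : (8 * w₀ * (w - w₀) ^ 3 - 3 * ((3 : AlgebraicClosure ℚ) ^ k * w + 8)) *
      ((3 : AlgebraicClosure ℚ) ^ k * w + 8) =
      -24 * ((3 : AlgebraicClosure ℚ) ^ k * w + 8) * w * (w - w₀) +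
        (8 * (3 : AlgebraicClosure ℚ) ^ k * w₀ * (K - w₀) * w - 8 * w₀ * (K - 4 * w₀) - 288 -
          48 * ((3 : AlgebraicClosure ℚ) ^ k * w) - 3 * ((3 : AlgebraicClosure ℚ) ^ k * w) ^ 2) := by
    rcases hw₀ with h | h <;> subst h
    · linear_combination (8 : AlgebraicClosure ℚ) * hR
    · linear_combination (-8 : AlgebraicClosure ℚ) * hR
  have h3k : v ((3 : AlgebraicClosure ℚ) ^ k * w) ≤ t := by
    rw [map_mul, map_pow, hw, mul_one]
    exact pow_le_of_le_one zero_le ht1.le (by omega)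
  have hrest : v (8 * (3 : AlgebraicClosure ℚ) ^ k * w₀ * (K - w₀) * w - 8 * w₀ * (K - 4 * w₀) - 288 -
      48 * ((3 : AlgebraicClosure ℚ) ^ k * w) - 3 * ((3 : AlgebraicClosure ℚ) ^ k * w) ^ 2) ≤ t ^ 2 := by
    have h16 : v (16 : AlgebraicClosure ℚ) = 1 := by simpa using hunit 16 (by decide)
    have h32 : v (32 : AlgebraicClosure ℚ) = 1 := by simpa using hunit 32 (by decide)
    have hKw₀ : v (K - w₀) ≤ t := by
      have e : K - w₀ = (K - 4 * w₀) + 3 * w₀ := by ring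
      rw [e]
      refine (Valuation.map_add _ _ _).trans (max_le (hK4.trans ht2t.le) ?_)
      rw [map_mul, hvw₀, mul_one]
    refine (Valuation.map_sub _ _ _).trans (max_le ?_ ?_)
    · refine (Valuation.map_sub _ _ _).trans (max_le ?_ ?_)
      · refine (Valuation.map_sub _ _ _).trans (max_le ?_ ?_)
        · refine (Valuation.map_sub _ _ _).trans (max_le ?_ ?_)
          · rw [map_mul, map_mul, map_mul, map_mul, h8, one_mul, map_pow, hvw₀, mul_one, hw, mul_one]
            calc t ^ k * v (K - w₀) ≤ t ^ 1 * t := mul_le_mul' (pow_le_pow_right_of_le_one' ht1.le hk) hKw₀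
              _ = t ^ 2 := by rw [pow_one, pow_two]
          · rw [map_mul, map_mul, h8, hvw₀, one_mul, one_mul]; exact hK4
        · rw [show (288 : AlgebraicClosure ℚ) = 32 * 3 ^ 2 by norm_num, map_mul, map_pow, h32, one_mul]
      · rw [show (48 : AlgebraicClosure ℚ) = 16 * 3 by norm_num, map_mul, map_mul, h16, one_mul, pow_two]
        exact mul_le_mul' le_rfl h3k
    · rw [map_mul, map_pow]
      calc t * v ((3 : AlgebraicClosure ℚ) ^ k * w) ^ 2 ≤ t * t ^ 2 :=
            mul_le_mul' le_rfl (pow_le_pow_left₀ zero_le h3k 2)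
        _ ≤ 1 * t ^ 2 := mul_le_mul' ht1.le le_rfl
        _ = t ^ 2 := one_mul _
  have hmain : v (-24 * ((3 : AlgebraicClosure ℚ) ^ k * w + 8) * w * (w - w₀)) = t * s := by
    rw [map_mul, map_mul, map_mul, Valuation.map_neg, show (24 : AlgebraicClosure ℚ) = 8 * 3 by norm_num,
      map_mul, h8, one_mul, h8', hw, mul_one, mul_one]
  have hsum : v (-24 * ((3 : AlgebraicClosure ℚ) ^ k * w + 8) * w * (w - w₀) +
      (8 * (3 : AlgebraicClosure ℚ) ^ k * w₀ * (K - w₀) * w - 8 * w₀ * (K - 4 * w₀) - 288 -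
        48 * ((3 : AlgebraicClosure ℚ) ^ k * w) - 3 * ((3 : AlgebraicClosure ℚ) ^ k * w) ^ 2)) = t * s := by
    rw [Valuation.map_add_eq_of_lt_left _ (by rw [hmain]; exact hrest.trans_lt ht2ts), hmain]
  have := congrArg v hid
  rw [map_mul, h8', mul_one, hsum] at this
  exact this

/-! ### §3 Assembly: the invariant has valuation `1/9` -/

/-- **The level-`9` Hauptmodul at `v₃(j) = 3k + 3 ≥ 6`, `j/3^{v₃(j)} ≡ 4w₀ (mod 9)` is
valuation-forced.**  Let `k ≥ 1`, `w₀ = ±1`, `j ∈ ℚ` with `9 ∣ num(j/3^{3k+3} − 4w₀)` (`K ≡ 4` for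
`w₀ = 1`, `K ≡ 5` for `w₀ = −1`), and `S, θ ∈ ℚ̄` with `j(S − 27) = S(S − 24)³`, `v(S) = v(3)` and
`θ³ = S`.  Then **`v((2((θ³ − 24)/3^{k+1} − w₀)/θ)² − 1)⁹ = v(3)`** — valuation exactly `1/9`.
[cite: Maier2006, Table 4 (N = 3, 9) and §5] -/
theorem valuation_hauptmodul_nine_invariant_vzero_four_pow_nine {j : ℚ} {k : ℕ} (hk : 1 ≤ k) {w₀ : ℤ}
    (hw₀ : w₀ = 1 ∨ w₀ = -1) (hj0 : (9 : ℤ) ∣ (j / 3 ^ (3 * k + 3) - ((4 * w₀ : ℤ) : ℚ)).num)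
    {S θ : AlgebraicClosure ℚ}
    (hS : algebraMap ℚ (AlgebraicClosure ℚ) j * (S - 27) = S * (S - 24) ^ 3)
    (hvS : (placeOver 3).valuation S = (placeOver 3).valuation (3 : AlgebraicClosure ℚ))
    (hθ : θ ^ 3 = S) :
    (placeOver 3).valuation
        ((2 * ((θ ^ 3 - 24) / 3 ^ (k + 1) - (w₀ : AlgebraicClosure ℚ)) / θ) ^ 2 - 1) ^ 9 =
      (placeOver 3).valuation (3 : AlgebraicClosure ℚ) := by
  set v := (placeOver 3).valuation with hv
  set t := v (3 : AlgebraicClosure ℚ) with ht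
  have ht1 : t < 1 := valuation_three_lt_one
  have ht0 : t ≠ 0 := valuation_three_ne_zero
  have h3 : (3 : AlgebraicClosure ℚ) ≠ 0 := by norm_num
  have hc3 : ¬ (3 : ℤ) ∣ 4 * w₀ := by rcases hw₀ with h | h <;> rw [h] <;> decide
  have hw₀' : (w₀ : AlgebraicClosure ℚ) = 1 ∨ (w₀ : AlgebraicClosure ℚ) = -1 := by
    rcases hw₀ with h | h
    · left; rw [h]; norm_num
    · right; rw [h]; norm_num
  have hsq : (w₀ : AlgebraicClosure ℚ) ^ 2 = 1 := by rcases hw₀' with h | h <;> rw [h] <;> norm_num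
  have hw₀3 : (w₀ : AlgebraicClosure ℚ) ^ 3 = w₀ := by rcases hw₀' with h | h <;> rw [h] <;> norm_num
  have hvw₀ : v (w₀ : AlgebraicClosure ℚ) = 1 := by
    rcases hw₀' with h | h
    · rw [h, map_one]
    · rw [h, Valuation.map_neg, map_one]
  -- `K = j/3^V ≡ 4w₀ (mod 9)`, a unit
  obtain ⟨hK4, hK, hjK⟩ := valuation_facts_of_nine_dvd_num_sub (V := 3 * k + 3) hc3 hj0
  set K := algebraMap ℚ (AlgebraicClosure ℚ) (j / 3 ^ (3 * k + 3)) with hKdef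
  simp only [Int.cast_mul, Int.cast_ofNat] at hK4
  -- `S = 3(3^k w + 8)`
  obtain ⟨w, hSw⟩ : ∃ w : AlgebraicClosure ℚ, S = 3 * (3 ^ k * w + 8) :=
    ⟨(S / 3 - 8) / 3 ^ k, by field_simp; ring⟩
  subst hSw
  have hR : w ^ 3 * ((3 : AlgebraicClosure ℚ) ^ k * w + 8) = K * ((3 : AlgebraicClosure ℚ) ^ k * w - 1) := by
    rw [hjK] at hS
    have h0 : (3 : AlgebraicClosure ℚ) ^ (3 * k + 4) *
        (w ^ 3 * ((3 : AlgebraicClosure ℚ) ^ k * w + 8) - K * ((3 : AlgebraicClosure ℚ) ^ k * w - 1)) = 0 := by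
      linear_combination (-1 : AlgebraicClosure ℚ) * hS
    exact sub_eq_zero.mp ((mul_eq_zero.mp h0).resolve_left (pow_ne_zero _ h3))
  have h8 : v ((3 : AlgebraicClosure ℚ) ^ k * w + 8) = 1 := by
    have := hvS
    rw [map_mul] at this
    have e : t * v ((3 : AlgebraicClosure ℚ) ^ k * w + 8) = t * 1 := by rw [mul_one]; exact this
    exact mul_left_cancel₀ ht0 e
  have hP0 : (3 : AlgebraicClosure ℚ) ^ k * w + 8 ≠ 0 :=
    (Valuation.ne_zero_iff _).mp (by rw [h8]; exact one_ne_zero)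
  have hθ0 : θ ≠ 0 := by
    intro h0
    rw [h0, zero_pow three_ne_zero] at hθ
    exact mul_ne_zero h3 hP0 hθ.symm
  have hw := valuation_w_eq_one hk hK h8 hR
  have hcube := valuation_w_cube_sub_eq_four hk hw₀' hK4 hw h8 hR
  have hs := valuation_w_sub_pow_three_eq hw₀' hcube
  set s := v (w - (w₀ : AlgebraicClosure ℚ)) with hsdef
  have hN := valuation_numerator_of_delta_quartic_four hk hw₀' hK4 hw h8 hR hs
  -- `Y = 2(w − w₀)/θ`, `X = +w₀ Y`, `(X³ − 1)θ³ = N'`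
  set Y := 2 * (w - (w₀ : AlgebraicClosure ℚ)) / θ with hYdef
  have hY : Y * θ = 2 * (w - w₀) := div_mul_cancel₀ _ hθ0
  have hX3 : (((w₀ : AlgebraicClosure ℚ) * Y) ^ 3 - 1) * θ ^ 3 =
      8 * w₀ * (w - w₀) ^ 3 - 3 * ((3 : AlgebraicClosure ℚ) ^ k * w + 8) := by
    linear_combination ((w₀ : AlgebraicClosure ℚ) ^ 3 * (Y ^ 2 * θ ^ 2 + 2 * Y * θ * (w - w₀) +
        4 * (w - w₀) ^ 2)) * hY + (8 * (w - (w₀ : AlgebraicClosure ℚ)) ^ 3) * hw₀3 + (-1 : AlgebraicClosure ℚ) * hθ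
  have hvθ3 : v θ ^ 3 = t := by rw [← map_pow, hθ, map_mul, h8, mul_one]
  have hX3v : v (((w₀ : AlgebraicClosure ℚ) * Y) ^ 3 - 1) = s := by
    have h := congrArg v hX3
    rw [map_mul, map_pow, hvθ3, hN] at h
    rw [mul_comm] at h
    exact mul_left_cancel₀ ht0 h
  have hXcube : v (((w₀ : AlgebraicClosure ℚ) * Y) ^ 3 - 1) ^ 3 = t := by rw [hX3v, hsdef, hs]
  have hX1 := valuation_sub_one_pow_nine_of_cube hXcube
  -- `Y² − 1 = (X − 1)(X + 1)` with `X + 1` a unit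
  have hfac : Y ^ 2 - 1 = ((w₀ : AlgebraicClosure ℚ) * Y - 1) * ((w₀ : AlgebraicClosure ℚ) * Y + 1) := by
    linear_combination (-Y ^ 2) * hsq
  have hXlt : v ((w₀ : AlgebraicClosure ℚ) * Y - 1) < 1 := by
    by_contra hge
    rw [not_lt] at hge
    have : (1 : _) ≤ v ((w₀ : AlgebraicClosure ℚ) * Y - 1) ^ 9 := one_le_pow₀ hge
    rw [hX1] at this
    exact absurd ht1 (not_lt.mpr this)
  have hunit : v ((w₀ : AlgebraicClosure ℚ) * Y + 1) = 1 := by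
    have e : (w₀ : AlgebraicClosure ℚ) * Y + 1 = 2 + ((w₀ : AlgebraicClosure ℚ) * Y - 1) := by ring
    have h2 : v (2 : AlgebraicClosure ℚ) = 1 := by
      simpa using valuation_intCast_eq_one_of_not_dvd (n := 2) (by decide)
    rw [e, Valuation.map_add_eq_of_lt_left _ (by rw [h2]; exact hXlt), h2]
  have hwθ : (θ ^ 3 - 24) / 3 ^ (k + 1) = w := by
    rw [hθ, pow_succ]; field_simp; ring
  rw [hwθ]
  change v (Y ^ 2 - 1) ^ 9 = t
  rw [hfac, map_mul, hunit, mul_one, hX1]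

end Summit.BirchSwinnertonDyer.Rank1Residual.GaloisImage
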